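import Summits.Ventures.HodgeRepro2.HeckeSlashNormalizer
import Summits.Ventures.HodgeRepro2.AtkinLehnerEigenvalues

/-!
# Lattice-stabilising unitary elements normalise every principal congruence subgroup `Γ_N`

Shimura's `Γ_N = {γ ∈ SU(H) : 𝔪 γ = 𝔪, (1 − γ) 𝔪 ⊆ N 𝔪}` (`shimuraLevel`, row-vector action) is
normalised by every `δ ∈ U(H)(K)` with `𝔪 δ = 𝔪`: for `s ∈ Γ_N`, `det (δ s δ⁻¹) = det s = 1`,
`𝔪 δ s δ⁻¹ = 𝔪`, and `x − x δ s δ⁻¹ = ((x δ) − (x δ) s) δ⁻¹ ∈ (N 𝔪) δ⁻¹ = N 𝔪`.  Consequently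
(rows 147–148) the Hecke operator `T_δ` on the weight-`k` forms for `Γ_N` is the single slash
`f ↦ f ∥_k δ`; for an involution `δ` it is an Atkin–Lehner-type involution with eigenvalues `±1`.
Together with `UnitaryReflection.lean`: a unitary reflection `r_v` (or `−r_v ∈ SU(H)`) that
stabilises the lattice gives such an involution of `S_k(Γ_N)`.
-/

namespace Summit.Ventures.HodgeRepro2.ShimuraData

open Matrix

variable {K : Type*} [Field K] [NumberField K] [NumberField.IsCMField K]

omit [NumberField K] [NumberField.IsCMField K] in
/-- `δ` stabilises the lattice `𝔪` in the row-vector action: `𝔪 δ ⊆ 𝔪` and `𝔪 δ⁻¹ ⊆ 𝔪`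
(the two clauses of `shimuraLevel` that do not involve the level). -/
def StabilizesLattice (𝔪 : Submodule ℤ (Fin 3 → K)) (δ : GL (Fin 3) K) : Prop :=
  (∀ x ∈ 𝔪, x ᵥ* (δ : Matrix (Fin 3) (Fin 3) K) ∈ 𝔪) ∧
    ∀ x ∈ 𝔪, x ᵥ* (δ : Matrix (Fin 3) (Fin 3) K)⁻¹ ∈ 𝔪

omit [NumberField K] [NumberField.IsCMField K] in
/-- The inverse of a lattice-stabilising element stabilises the lattice. -/
theorem StabilizesLattice.inv {𝔪 : Submodule ℤ (Fin 3 → K)} {δ : GL (Fin 3) K}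
    (h : StabilizesLattice 𝔪 δ) : StabilizesLattice 𝔪 δ⁻¹ := by
  refine ⟨?_, ?_⟩
  · intro x hx
    rw [coe_units_inv]
    exact h.2 x hx
  · intro x hx
    rw [coe_units_inv, nonsing_inv_nonsing_inv _ ((isUnit_iff_isUnit_det _).mp δ.isUnit)]
    exact h.1 x hx

omit [NumberField K] [NumberField.IsCMField K] in
/-- For an involution (`δ * δ = 1`) the first clause suffices. -/
theorem StabilizesLattice.of_sq_eq_one {𝔪 : Submodule ℤ (Fin 3 → K)} {δ : GL (Fin 3) K}
    (hδ : δ * δ = 1) (h : ∀ x ∈ 𝔪, x ᵥ* (δ : Matrix (Fin 3) (Fin 3) K) ∈ 𝔪) :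
    StabilizesLattice 𝔪 δ := by
  refine ⟨h, ?_⟩
  have hδδ : (δ : Matrix (Fin 3) (Fin 3) K) * δ = 1 := by
    rw [← Units.val_mul, hδ, Units.val_one]
  rw [inv_eq_left_inv hδδ]
  exact h

omit [NumberField K] [NumberField.IsCMField K] in
/-- A lattice vector is recovered from its image: `x = (x δ) δ⁻¹`. -/
lemma vecMul_vecMul_inv_self (δ : GL (Fin 3) K) (x : Fin 3 → K) :
    (x ᵥ* (δ : Matrix (Fin 3) (Fin 3) K)) ᵥ* (δ : Matrix (Fin 3) (Fin 3) K)⁻¹ = x := by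
  rw [vecMul_vecMul, mul_nonsing_inv _ ((isUnit_iff_isUnit_det _).mp δ.isUnit), vecMul_one]

/-- **Conjugation by a lattice-stabilising unitary element preserves `Γ_N`**:
`s ∈ Γ_N ⇒ δ s δ⁻¹ ∈ Γ_N` for `δ ∈ U(H)(K)` with `𝔪 δ = 𝔪`. -/
theorem mem_shimuraLevel_conj {H : Matrix (Fin 3) (Fin 3) K} {𝔪 : Submodule ℤ (Fin 3 → K)} {N : ℕ}
    {δ : GL (Fin 3) K} (hδ : δ ∈ unitaryGroup K H) (hst : StabilizesLattice 𝔪 δ)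
    {s : GL (Fin 3) K} (hs : s ∈ shimuraLevelSubgroup K H 𝔪 N) :
    δ * s * δ⁻¹ ∈ shimuraLevelSubgroup K H 𝔪 N := by
  have hs' : s ∈ shimuraLevel K H 𝔪 N := hs
  unfold shimuraLevel at hs'
  obtain ⟨hsu, h1, h2, h3⟩ := hs'
  have hdet : Matrix.GeneralLinearGroup.det s = 1 := MonoidHom.mem_ker.mp (Subgroup.mem_inf.mp hsu).2
  have hsU : s ∈ unitaryGroup K H := (Subgroup.mem_inf.mp hsu).1
  have hdetU : IsUnit (δ : Matrix (Fin 3) (Fin 3) K).det := (isUnit_iff_isUnit_det _).mp δ.isUnit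
  show δ * s * δ⁻¹ ∈ shimuraLevel K H 𝔪 N
  unfold shimuraLevel
  refine ⟨?_, ?_, ?_, ?_⟩
  · refine Subgroup.mem_inf.mpr ⟨(unitaryGroup K H).mul_mem ((unitaryGroup K H).mul_mem hδ hsU)
      ((unitaryGroup K H).inv_mem hδ), ?_⟩
    rw [MonoidHom.mem_ker, map_mul, map_mul, map_inv, hdet, mul_one, mul_inv_cancel]
  · intro x hx
    rw [Units.val_mul, Units.val_mul, coe_units_inv, ← vecMul_vecMul, ← vecMul_vecMul]
    exact hst.2 _ (h1 _ (hst.1 x hx))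
  · intro x hx
    rw [_root_.mul_inv_rev, _root_.mul_inv_rev, inv_inv, Units.val_mul, Units.val_mul, coe_units_inv δ,
      ← mul_assoc, ← vecMul_vecMul, ← vecMul_vecMul]
    exact hst.2 _ (h2 _ (hst.1 x hx))
  · intro x hx
    obtain ⟨y, hy, hxy⟩ := h3 (x ᵥ* (δ : Matrix (Fin 3) (Fin 3) K)) (hst.1 x hx)
    refine ⟨y ᵥ* (δ : Matrix (Fin 3) (Fin 3) K)⁻¹, hst.2 y hy, ?_⟩
    rw [Units.val_mul, Units.val_mul, coe_units_inv, ← vecMul_vecMul, ← vecMul_vecMul,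
      ← smul_vecMul, ← hxy, sub_vecMul, vecMul_vecMul_inv_self]

/-- **Lattice-stabilising unitary elements normalise `Γ_N`**:
`s ∈ Γ_N ↔ δ s δ⁻¹ ∈ Γ_N` — the hypothesis of rows 147–148 (`hecke_eq_slash_of_normalizes`). -/
theorem mem_shimuraLevel_conj_iff {H : Matrix (Fin 3) (Fin 3) K} {𝔪 : Submodule ℤ (Fin 3 → K)}
    {N : ℕ} {δ : GL (Fin 3) K} (hδ : δ ∈ unitaryGroup K H) (hst : StabilizesLattice 𝔪 δ)
    (s : GL (Fin 3) K) :
    s ∈ shimuraLevelSubgroup K H 𝔪 N ↔ δ * s * δ⁻¹ ∈ shimuraLevelSubgroup K H 𝔪 N := by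
  refine ⟨fun hs => mem_shimuraLevel_conj hδ hst hs, fun hs => ?_⟩
  have := mem_shimuraLevel_conj ((unitaryGroup K H).inv_mem hδ) hst.inv hs
  have h' : δ⁻¹ * (δ * s * δ⁻¹) * δ⁻¹⁻¹ = s := by group
  rwa [h'] at this

/-- `Γ_N ⊆ U(H)(K)` (as sets). -/
theorem shimuraLevelSubgroup_subset_unitaryGroup (H : Matrix (Fin 3) (Fin 3) K)
    (𝔪 : Submodule ℤ (Fin 3 → K)) (N : ℕ) :
    (shimuraLevelSubgroup K H 𝔪 N : Set (GL (Fin 3) K)) ⊆ (unitaryGroup K H : Set (GL (Fin 3) K)) :=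
  subset_unitaryGroup_of_subset_shimuraLevel (coe_shimuraLevelSubgroup K H 𝔪 N).subset

/-- **`T_δ` is the slash by `δ` on the forms for `Γ_N`** when `δ ∈ U(H)(K)` stabilises the
lattice: `(T_δ f)(z) = (f ∥_k δ)(z)` on the ball. -/
theorem hecke_eq_slash_of_stabilizesLattice {τ₁ : K →+* ℂ} {H : Matrix (Fin 3) (Fin 3) K}
    {Q : Matrix (Fin 3) (Fin 3) ℂ} (hQ : IsFrame K τ₁ H Q) {𝔪 : Submodule ℤ (Fin 3 → K)} {N : ℕ}
    {δ : GL (Fin 3) K} (hδ : δ ∈ unitaryGroup K H) (hst : StabilizesLattice 𝔪 δ)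
    [Fintype (shimuraLevelSubgroup K H 𝔪 N ⧸
      (heckeSubgroup (shimuraLevelSubgroup K H 𝔪 N) δ).subgroupOf (shimuraLevelSubgroup K H 𝔪 N))]
    {k : ℕ} {f : (Fin 2 → ℂ) → ℂ} (hf : IsWeightFor τ₁ Q (shimuraLevelSubgroup K H 𝔪 N) k f)
    {z : Fin 2 → ℂ} (hz : z ∈ ball₂) :
    hecke (shimuraLevelSubgroup K H 𝔪 N) δ τ₁ Q k f z = slash k (realEmbedding K τ₁ Q δ) f z :=
  hecke_eq_slash_of_normalizes hQ (shimuraLevelSubgroup_subset_unitaryGroup H 𝔪 N)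
    (mem_shimuraLevel_conj_iff hδ hst) hδ hf hz

/-- **An Atkin–Lehner-type involution of the forms for `Γ_N`**: for a lattice-stabilising
involution `δ ∈ U(H)(K)`, `T_δ ∘ T_δ = id` on the ball. -/
theorem hecke_hecke_eq_self_of_stabilizesLattice {τ₁ : K →+* ℂ} {H : Matrix (Fin 3) (Fin 3) K}
    {Q : Matrix (Fin 3) (Fin 3) ℂ} (hQ : IsFrame K τ₁ H Q) {𝔪 : Submodule ℤ (Fin 3 → K)} {N : ℕ}
    {δ : GL (Fin 3) K} (hδ : δ ∈ unitaryGroup K H) (hδδ : δ * δ = 1)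
    (h : ∀ x ∈ 𝔪, x ᵥ* (δ : Matrix (Fin 3) (Fin 3) K) ∈ 𝔪)
    [Fintype (shimuraLevelSubgroup K H 𝔪 N ⧸
      (heckeSubgroup (shimuraLevelSubgroup K H 𝔪 N) δ).subgroupOf (shimuraLevelSubgroup K H 𝔪 N))]
    {k : ℕ} {f : (Fin 2 → ℂ) → ℂ} (hf : IsWeightFor τ₁ Q (shimuraLevelSubgroup K H 𝔪 N) k f)
    {z : Fin 2 → ℂ} (hz : z ∈ ball₂) :
    hecke (shimuraLevelSubgroup K H 𝔪 N) δ τ₁ Q k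
      (hecke (shimuraLevelSubgroup K H 𝔪 N) δ τ₁ Q k f) z = f z :=
  hecke_hecke_eq_self_of_normalizes_of_sq_eq_one hQ (shimuraLevelSubgroup_subset_unitaryGroup H 𝔪 N)
    (mem_shimuraLevel_conj_iff hδ (StabilizesLattice.of_sq_eq_one hδδ h)) hδ hδδ hf hz

end Summit.Ventures.HodgeRepro2.ShimuraData
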